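import Literature.AlgebraicGeometry.ComplexMultiplication.CurveTimesMultiquadraticCMWeights
import Literature.AlgebraicGeometry.Pohlmann1968.HodgeClassesProductSpanCMProductsSharp
import Literature.AlgebraicGeometry.Pohlmann1968.SimpleCMAbelianVarietyPowersDivisorGenerated
import Literature.AlgebraicGeometry.HodgeTheory.HodgeClassesProductSpanTransport
import HarnessLib

/-!
# The Weil classes of `k` on `E^d × Y`, `d` the signature defect: for `E` a CM elliptic curve (CM field `k`) and `Y` a
# realisation of ANY CM type `Φ` of ANY number field `K ⊇ k`, the power `E^{|n − n̄|} × Y` lacks the product-span property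

COR-CM (cell `pub-hodgecm2`, binder seat `b25` gen 35, count-neutral claim PRODSPAN-POWERS (F19)); NEW as stated, hence
under `Summits/`.  Theorems only; no definition, no named fact, no `sorry`.  Generalises `CorCM/CurveTimesMultiquadraticCMSquare`
(octic multiquadratic `K`: `E² × Y`) and reads `CorCM/CMEllipticCurveTimesSimpleCMThreefoldWeilClass` (seat b16, sextic
`K`: `E × T`) in product-span language, with NO Galois or commutativity hypothesis on `K`.

SETTING.  `k` imaginary quadratic (`[k:ℚ] = 2`), `e : k → K` a ring embedding into a number field `K`, `Φ_k` a CM type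
of `k` with member `x ∈ Φ_k`, `Φ` a CM type of `K`.  The fibres of `Hom(K,ℂ) → Hom(k,ℂ)` over `x` and `x̄` are
exchanged by complex conjugation and by every `τ ∈ Aut(ℂ)` with `τ ∘ x = x̄`, and preserved by the `τ` with
`τ ∘ x = x`; let `n = #{s ∈ Φ | s ∘ e = x}`, `n̄ = #{s ∈ Φ | s ∘ e = x̄}` (the `k`-SIGNATURE of `(Y, k ⊆ End⁰ Y)`; the
fibre of `x` has `n + n̄` elements).

* **`not_hodgeClassesProductSpan_powSucc_curve_of_fibre_lt`** — if `n + c + 1 = n̄` then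
  `¬ HodgeClassesProductSpan (E.powSucc c) Y`: the `0/1`-weight `S = {(i, x) | i ≤ c} ⊔ {(0, s) | s ∘ e = x}` of
  `E^{c+1} × Y` (`|S| = 2n̄`) is Galois balanced — a `τ` fixing `x` counts `(c+1) + n = n̄`, a `τ` moving `x` to `x̄ ∉ Φ_k`
  counts `0 + n̄` — while its `E^{c+1}`-block (all embeddings equal to `x ∈ Φ_k`) is not; by
  `Pohlmann1968.blocksSplit_of_hodgeClassesProductSpan_biproduct` the product-span property fails.  These are the Weil
  classes of `k` on `E^{n̄−n} × Y` (Moonen–Zarhin (0.2); Deligne §4).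
* **`not_hodgeClassesProductSpan_powSucc_curve_of_lt_fibre`** — the symmetric case `n̄ + c + 1 = n` (weight
  `{(i, x)} ⊔` fibre of `x̄`).
* `exists_not_hodgeClassesProductSpan_powSucc_curve_of_fibre_ne` — `n ≠ n̄ ⟹ ∃ c < max n n̄, ¬ …`; for `[K:k]` odd the
  signature is always unbalanced.

So for a CM elliptic curve `E ⊆` (up to isogeny) the CM of `Y`: the exponent at which the mixed Weil classes appear is
EXACTLY the signature defect `|n − n̄|` — `1` for simple CM threefolds (`(2,1)`), `2` for nondegenerate octic
multiquadratic fourfolds (`(3,1)`), never `0` unless `Hg(E × Y) = Hg(E) × Hg(Y)`.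

## References
* [MoonenZarhin1999LowDim] B. Moonen, Yu. Zarhin, Math. Ann. 315 (1999) 711–733, Thm. (0.2), §3 (3.1).
* [Deligne1982HodgeCycles] P. Deligne, *Hodge cycles on abelian varieties*, LNM 900 (1982), §4 (Weil classes), Prop. 4.4.
* [Gordon1999HodgeAVSurvey] B. B. Gordon, *A survey of the Hodge conjecture for abelian varieties*, 7.5, §9.2.

Provenance: Literature home (namespace `Literature.AlgebraicGeometry.ComplexMultiplication.Multiquadratic`) of the Summits-side `CorCM/CurveTimesCMFieldWeilPower` (cell `pub-hodgecm2`, COR-CM; all its imports are `Literature/`, Mathlib and the already re-homed `CurveTimesMultiquadraticCMWeights`), which `Literature/` may not import; theorems only, no named fact, no definition. Nothing here bears on `HC_CM`. Lane `lit-hodgefound` (Layer A3: CM types, their Kubota ranks and Galois combinatorics), seat p20.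
-/

noncomputable section

open _root_.CategoryTheory _root_.CategoryTheory.Limits NumberField

namespace Literature.AlgebraicGeometry.ComplexMultiplication.Multiquadratic

open Literature.AlgebraicGeometry.Motives (AbelianVariety CMType)
open Literature.AlgebraicGeometry.Motives.AbelianVariety
open Literature.AlgebraicGeometry.HodgeTheory
open Literature.AlgebraicGeometry.ComplexMultiplication (IsCMTypeRealisation)
open Literature.AlgebraicGeometry.Pohlmann1968
open Literature.NumberTheory.ComplexMultiplication

open scoped Classical

section WeilPower

variable {k : Type} [Field k] [NumberField k]
  {K : Type} [Field K] [NumberField K]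
  {Φk : CMType k} {Φ : CMType K}
  {E Y : AbelianVariety ℂ} {ιE : 𝓞 k →+* End E} {ιY : 𝓞 K →+* End Y}
  {θE : k →+* Module.End ℂ (complexBetti E.X 1)} {θY : K →+* Module.End ℂ (complexBetti Y.X 1)}

/-- `τ⁻¹ ∘ (τ ∘ s) = s`. [cite: Deligne1982HodgeCycles, §4] -/
private theorem symm_comp_comp (τ : ℂ ≃+* ℂ) {F : Type} [Field F] (s : F →+* ℂ) :
    ((τ.symm : ℂ ≃+* ℂ) : ℂ →+* ℂ).comp (((τ : ℂ ≃+* ℂ) : ℂ →+* ℂ).comp s) = s :=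
  RingHom.ext fun y => τ.symm_apply_apply (s y)

/-- `τ ∘ (τ⁻¹ ∘ t) = t`. [cite: Deligne1982HodgeCycles, §4] -/
private theorem comp_symm_comp (τ : ℂ ≃+* ℂ) {F : Type} [Field F] (t : F →+* ℂ) :
    ((τ : ℂ ≃+* ℂ) : ℂ →+* ℂ).comp (((τ.symm : ℂ ≃+* ℂ) : ℂ →+* ℂ).comp t) = t :=
  RingHom.ext fun y => τ.apply_symm_apply (t y)

omit [NumberField k] in
/-- **An automorphism moves the fibre over `x` onto the fibre over `τ ∘ x`, matching members of `Φ` translated by `τ`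
with members of `Φ`**: `#{s | s ∘ e = x, τ ∘ s ∈ Φ} = #{t | t ∘ e = τ ∘ x, t ∈ Φ}`. [cite: Deligne1982HodgeCycles, §4] -/
private theorem card_fibre_comp_mem_eq (e : k →+* K) (Φ : CMType K) (τ : ℂ ≃+* ℂ) (x : k →+* ℂ) :
    (Finset.univ.filter fun s : K →+* ℂ => s.comp e = x ∧ ((τ : ℂ →+* ℂ).comp s) ∈ Φ.1).card =
      (Finset.univ.filter fun t : K →+* ℂ => t.comp e = (τ : ℂ →+* ℂ).comp x ∧ t ∈ Φ.1).card := by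
  refine Finset.card_nbij' (fun s => ((τ : ℂ ≃+* ℂ) : ℂ →+* ℂ).comp s) (fun t => ((τ.symm : ℂ ≃+* ℂ) : ℂ →+* ℂ).comp t)
    ?_ ?_ (fun s _ => symm_comp_comp τ s) (fun t _ => comp_symm_comp τ t)
  · intro s hs
    rw [Finset.mem_coe, Finset.mem_filter] at hs ⊢
    exact ⟨Finset.mem_univ _, by rw [RingHom.comp_assoc, hs.2.1], hs.2.2⟩
  · intro t ht
    rw [Finset.mem_coe, Finset.mem_filter] at ht ⊢
    refine ⟨Finset.mem_univ _, ?_, by rw [comp_symm_comp]; exact ht.2.2⟩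
    rw [RingHom.comp_assoc, ht.2.1, ← RingHom.comp_assoc]
    exact symm_comp_comp τ x

omit [NumberField k] in
/-- **The fibre over `x` has `n + n̄` elements**: its members outside `Φ` are the conjugates of the members of `Φ` in the
fibre over `x̄`. [cite: Deligne1982HodgeCycles, §4] -/
private theorem card_fibre_eq (e : k →+* K) (Φ : CMType K) (x : k →+* ℂ) :
    (Finset.univ.filter fun s : K →+* ℂ => s.comp e = x).card =
      (Finset.univ.filter fun s : K →+* ℂ => s.comp e = x ∧ s ∈ Φ.1).card +
        (Finset.univ.filter fun t : K →+* ℂ => t.comp e = ComplexEmbedding.conjugate x ∧ t ∈ Φ.1).card := by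
  have hsplit := Finset.card_filter_add_card_filter_not
    (s := Finset.univ.filter fun s : K →+* ℂ => s.comp e = x) (fun s => s ∈ Φ.1)
  rw [Finset.filter_filter, Finset.filter_filter] at hsplit
  rw [← hsplit]
  congr 1
  -- conjugation: `{s | s ∘ e = x, s ∉ Φ} ≃ {t | t ∘ e = x̄, t ∈ Φ}`
  refine Finset.card_nbij' (fun s => ComplexEmbedding.conjugate s) (fun t => ComplexEmbedding.conjugate t)
    ?_ ?_ (fun s _ => ComplexEmbedding.involutive_conjugate K s) (fun t _ => ComplexEmbedding.involutive_conjugate K t)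
  · intro s hs
    rw [Finset.mem_coe, Finset.mem_filter] at hs ⊢
    refine ⟨Finset.mem_univ _, ?_, (conjugate_mem_iff Φ s).2 hs.2.2⟩
    rw [← hs.2.1]; rfl
  · intro t ht
    rw [Finset.mem_coe, Finset.mem_filter] at ht ⊢
    refine ⟨Finset.mem_univ _, ?_, fun h => ((Φ.2 t).1 ht.2.2) h⟩
    have h1 : (ComplexEmbedding.conjugate t).comp e = ComplexEmbedding.conjugate (t.comp e) := rfl
    rw [h1, ht.2.1, ComplexEmbedding.involutive_conjugate k x]

/-- The core: a weight with `c + 1` slots of `E` all carrying `x ∈ Φ_k` and the fibre over `y` on `Y`, balanced with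
value `p`, refutes the product-span property of `E^{c+1} × Y`. [cite: MoonenZarhin1999LowDim, §3 (3.1)] -/
private theorem not_span_of_weight (e : k →+* K) {x y : k →+* ℂ} (hxΦ : x ∈ Φk.1) {c p : ℕ}
    (hcount : ∀ τ : ℂ ≃+* ℂ, (if (τ : ℂ →+* ℂ).comp x ∈ Φk.1 then c + 1 else 0) +
      (Finset.univ.filter fun t : K →+* ℂ => t.comp e = (τ : ℂ →+* ℂ).comp y ∧ t ∈ Φ.1).card = p)
    (hcard : c + 1 + (Finset.univ.filter fun s : K →+* ℂ => s.comp e = y).card = 2 * p)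
    (hE : IsCMTypeRealisation Φk E ιE θE) (hY : IsCMTypeRealisation Φ Y ιY θY) :
    ¬ HodgeClassesProductSpan (E.powSucc c) Y := by
  intro hspan
  have hspan' : HodgeClassesProductSpan (⨁ fun _ : Fin (c + 1) => E) (⨁ fun _ : Fin 1 => Y) :=
    hspan.of_isIsogenous' (isIsogenous_powSucc_biproduct E c) (isIsogenous_powSucc_biproduct Y 0)
  -- the weight
  let S₁ : Finset ((_ : Fin (c + 1)) × (k →+* ℂ)) := Finset.univ.image fun i : Fin (c + 1) => ⟨i, x⟩
  let emb : (K →+* ℂ) → (_ : Fin 1) × (K →+* ℂ) := fun s => ⟨0, s⟩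
  have hemb : Function.Injective emb := fun s s' h => eq_of_heq (Sigma.mk.inj h).2
  let S₂ : Finset ((_ : Fin 1) × (K →+* ℂ)) := (Finset.univ.filter fun s : K →+* ℂ => s.comp e = y).image emb
  have hinj₁ : Function.Injective fun i : Fin (c + 1) => (⟨i, x⟩ : (_ : Fin (c + 1)) × (k →+* ℂ)) :=
    fun i i' h => (Sigma.mk.inj_iff.mp h).1
  have hS1card : S₁.card = c + 1 := by
    rw [Finset.card_image_of_injective _ hinj₁, Finset.card_univ, Fintype.card_fin]
  have hS1count : ∀ P : (k →+* ℂ) → Prop, {t | t ∈ S₁ ∧ P t.2}.ncard = if P x then c + 1 else 0 := by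
    intro P
    by_cases hP : P x
    · rw [if_pos hP]
      have : {t | t ∈ S₁ ∧ P t.2} = ↑S₁ := Set.ext fun t => ⟨fun h => h.1, fun h => ⟨h, by
        obtain ⟨i, -, rfl⟩ := Finset.mem_image.1 (Finset.mem_coe.1 h); exact hP⟩⟩
      rw [this, Set.ncard_coe_finset, hS1card]
    · rw [if_neg hP]
      have : {t | t ∈ S₁ ∧ P t.2} = ∅ := by
        ext t
        simp only [Set.mem_setOf_eq, Set.mem_empty_iff_false, iff_false, not_and]
        intro ht
        obtain ⟨i, -, rfl⟩ := Finset.mem_image.1 ht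
        exact hP
      rw [this, Set.ncard_empty]
  have hS2count : ∀ P : (K →+* ℂ) → Prop, {z | z ∈ S₂ ∧ P z.2}.ncard =
      (Finset.univ.filter fun s : K →+* ℂ => s.comp e = y ∧ P s).card := by
    intro P
    rw [ncard_sep_eq_card_filter, Finset.filter_image, Finset.card_image_of_injective _ hemb, Finset.filter_filter]
  have hS2card : S₂.card = (Finset.univ.filter fun s : K →+* ℂ => s.comp e = y).card :=
    Finset.card_image_of_injective _ hemb
  -- Galois balance with value `p`
  have hbal : ∀ τ : ℂ ≃+* ℂ,
      {z | z ∈ S₁.disjSum S₂ ∧ Sum.elim (fun t : (_ : Fin (c + 1)) × (k →+* ℂ) => (τ : ℂ →+* ℂ).comp t.2 ∈ Φk.1)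
        (fun z : (_ : Fin 1) × (K →+* ℂ) => (τ : ℂ →+* ℂ).comp z.2 ∈ Φ.1) z}.ncard = p ∧
      {z | z ∈ S₁.disjSum S₂ ∧ ¬ Sum.elim (fun t : (_ : Fin (c + 1)) × (k →+* ℂ) => (τ : ℂ →+* ℂ).comp t.2 ∈ Φk.1)
        (fun z : (_ : Fin 1) × (K →+* ℂ) => (τ : ℂ →+* ℂ).comp z.2 ∈ Φ.1) z}.ncard = p := by
    intro τ
    have hin : {z | z ∈ S₁.disjSum S₂ ∧ Sum.elim (fun t : (_ : Fin (c + 1)) × (k →+* ℂ) =>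
        (τ : ℂ →+* ℂ).comp t.2 ∈ Φk.1) (fun z : (_ : Fin 1) × (K →+* ℂ) => (τ : ℂ →+* ℂ).comp z.2 ∈ Φ.1) z}.ncard = p := by
      rw [ncard_sep_eq_add, Finset.toLeft_disjSum, Finset.toRight_disjSum]
      simp only [Sum.elim_inl, Sum.elim_inr]
      rw [hS1count (fun s => (τ : ℂ →+* ℂ).comp s ∈ Φk.1), hS2count (fun s => (τ : ℂ →+* ℂ).comp s ∈ Φ.1),
        card_fibre_comp_mem_eq e Φ τ y]
      exact hcount τ
    refine ⟨hin, ?_⟩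
    have htot := ncard_add_ncard_not (S₁.disjSum S₂)
      (Sum.elim (fun t : (_ : Fin (c + 1)) × (k →+* ℂ) => (τ : ℂ →+* ℂ).comp t.2 ∈ Φk.1)
        (fun z : (_ : Fin 1) × (K →+* ℂ) => (τ : ℂ →+* ℂ).comp z.2 ∈ Φ.1))
    rw [hin, Finset.card_disjSum, hS1card, hS2card] at htot
    omega
  -- the product-span property would balance the `E^{c+1}`-block: absurd
  obtain ⟨p₁, p₂, -, h₁, -⟩ := blocksSplit_of_hodgeClassesProductSpan_biproduct (K := fun _ : Fin (c + 1) => k)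
    (K' := fun _ : Fin 1 => K) (Φ := fun _ => Φk) (Φ' := fun _ => Φ) (A := fun _ => E) (A' := fun _ => Y)
    (ι := fun _ => ιE) (ι' := fun _ => ιY) (θ := fun _ => θE) (θ' := fun _ => θY) (fun _ => hE) (fun _ => hY)
    hspan' (S₁.disjSum S₂) p hbal
  rw [Finset.toLeft_disjSum] at h₁
  have hb := isGaloisBalancedAlg_iff.1 (mem_pohlmannSetsAlg_iff.1 h₁).2 1
  change {t | t ∈ S₁ ∧ ((1 : ℂ ≃+* ℂ) : ℂ →+* ℂ).comp t.2 ∈ Φk.1}.ncard =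
    {t | t ∈ S₁ ∧ ¬ ((1 : ℂ ≃+* ℂ) : ℂ →+* ℂ).comp t.2 ∈ Φk.1}.ncard at hb
  rw [hS1count (fun s => ((1 : ℂ ≃+* ℂ) : ℂ →+* ℂ).comp s ∈ Φk.1),
    hS1count (fun s => ¬ ((1 : ℂ ≃+* ℂ) : ℂ →+* ℂ).comp s ∈ Φk.1)] at hb
  have h1x : ((1 : ℂ ≃+* ℂ) : ℂ →+* ℂ).comp x = x := RingHom.ext fun _ => rfl
  rw [h1x, if_pos hxΦ, if_neg (not_not.2 hxΦ)] at hb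
  omega

/-- **The Weil classes of `k` on `E^{n̄−n} × Y`.**  `k` imaginary quadratic, `e : k → K`, `x ∈ Φ_k`, `Φ` a CM type of the
number field `K`, `n = #{s ∈ Φ | s ∘ e = x}`, `n̄ = #{s ∈ Φ | s ∘ e = x̄}`; `E`, `Y` realisations of `(k; Φ_k)`, `(K; Φ)`.
If `n + c + 1 = n̄` then `E^{c+1} × Y` carries a rational Hodge class outside the span of exterior products of Hodge
classes of `E^{c+1}` and of `Y`: `¬ HodgeClassesProductSpan (E.powSucc c) Y`.  NO hypothesis on `K` beyond carrying a
CM type. [cite: MoonenZarhin1999LowDim, Thm. (0.2) and §3 (3.1)] [cite: Deligne1982HodgeCycles, §4] -/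
theorem not_hodgeClassesProductSpan_powSucc_curve_of_fibre_lt (hk : Module.finrank ℚ k = 2) (e : k →+* K)
    {x : k →+* ℂ} (hxΦ : x ∈ Φk.1) {c : ℕ}
    (hc : (Finset.univ.filter fun s : K →+* ℂ => s.comp e = x ∧ s ∈ Φ.1).card + c + 1 =
      (Finset.univ.filter fun t : K →+* ℂ => t.comp e = ComplexEmbedding.conjugate x ∧ t ∈ Φ.1).card)
    (hE : IsCMTypeRealisation Φk E ιE θE) (hY : IsCMTypeRealisation Φ Y ιY θY) :
    ¬ HodgeClassesProductSpan (E.powSucc c) Y := by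
  have hxbar : ComplexEmbedding.conjugate x ∉ Φk.1 := (Φk.2 x).1 hxΦ
  refine not_span_of_weight e (y := x) hxΦ
    (p := (Finset.univ.filter fun t : K →+* ℂ => t.comp e = ComplexEmbedding.conjugate x ∧ t ∈ Φ.1).card)
    (fun τ => ?_) (by rw [card_fibre_eq e Φ x]; omega) hE hY
  rcases eq_or_eq_conjugate Φk hk x ((τ : ℂ →+* ℂ).comp x) with h | h
  · rw [h, if_pos hxΦ]; omega
  · rw [h, if_neg hxbar, zero_add]

/-- **The symmetric case `n̄ < n`**: if `n̄ + c + 1 = n` then `¬ HodgeClassesProductSpan (E.powSucc c) Y` (the weight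
`{(i, x)} ⊔` fibre of `x̄`; here `k` must be a CM field so that `τ ∘ x̄ = (τ ∘ x)‾`).
[cite: MoonenZarhin1999LowDim, Thm. (0.2) and §3 (3.1)] [cite: Deligne1982HodgeCycles, §4] -/
theorem not_hodgeClassesProductSpan_powSucc_curve_of_lt_fibre [IsCMField k] (hk : Module.finrank ℚ k = 2) (e : k →+* K)
    {x : k →+* ℂ} (hxΦ : x ∈ Φk.1) {c : ℕ}
    (hc : (Finset.univ.filter fun t : K →+* ℂ => t.comp e = ComplexEmbedding.conjugate x ∧ t ∈ Φ.1).card + c + 1 =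
      (Finset.univ.filter fun s : K →+* ℂ => s.comp e = x ∧ s ∈ Φ.1).card)
    (hE : IsCMTypeRealisation Φk E ιE θE) (hY : IsCMTypeRealisation Φ Y ιY θY) :
    ¬ HodgeClassesProductSpan (E.powSucc c) Y := by
  have hxbar : ComplexEmbedding.conjugate x ∉ Φk.1 := (Φk.2 x).1 hxΦ
  -- `τ x̄ = (τ x)‾` on the CM field `k`
  have hconj : ∀ τ : ℂ ≃+* ℂ, (τ : ℂ →+* ℂ).comp (ComplexEmbedding.conjugate x) =
      ComplexEmbedding.conjugate ((τ : ℂ →+* ℂ).comp x) := fun τ => by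
    have h := (isCMTypeWith_conj Φk).comm τ x
    rw [conj_smul_eq_conjugate, conj_smul_eq_conjugate] at h
    exact h
  refine not_span_of_weight e (y := ComplexEmbedding.conjugate x) hxΦ
    (p := (Finset.univ.filter fun s : K →+* ℂ => s.comp e = x ∧ s ∈ Φ.1).card)
    (fun τ => ?_) (by rw [card_fibre_eq e Φ (ComplexEmbedding.conjugate x), ComplexEmbedding.involutive_conjugate k x]; omega)
    hE hY
  rw [hconj τ]
  rcases eq_or_eq_conjugate Φk hk x ((τ : ℂ →+* ℂ).comp x) with h | h
  · rw [h, if_pos hxΦ]; omega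
  · rw [h, if_neg hxbar, zero_add, ComplexEmbedding.involutive_conjugate k x]

/-- **Unbalanced signature ⟹ some explicit power fails**: if `n ≠ n̄` then for `c + 1 = |n − n̄|`,
`¬ HodgeClassesProductSpan (E.powSucc c) Y` — the exponent at which the `k`-Weil classes appear is the signature defect.
(For `[K : k]` odd, `n + n̄ = [K:k]` forces `n ≠ n̄`.) [cite: MoonenZarhin1999LowDim, Thm. (0.2) and §3 (3.1)] -/
theorem exists_not_hodgeClassesProductSpan_powSucc_curve_of_fibre_ne [IsCMField k] (hk : Module.finrank ℚ k = 2)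
    (e : k →+* K) {x : k →+* ℂ} (hxΦ : x ∈ Φk.1)
    (hne : (Finset.univ.filter fun s : K →+* ℂ => s.comp e = x ∧ s ∈ Φ.1).card ≠
      (Finset.univ.filter fun t : K →+* ℂ => t.comp e = ComplexEmbedding.conjugate x ∧ t ∈ Φ.1).card)
    (hE : IsCMTypeRealisation Φk E ιE θE) (hY : IsCMTypeRealisation Φ Y ιY θY) :
    ∃ c : ℕ, c + 1 = Int.natAbs
        (((Finset.univ.filter fun s : K →+* ℂ => s.comp e = x ∧ s ∈ Φ.1).card : ℤ) -
          (Finset.univ.filter fun t : K →+* ℂ => t.comp e = ComplexEmbedding.conjugate x ∧ t ∈ Φ.1).card) ∧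
      ¬ HodgeClassesProductSpan (E.powSucc c) Y := by
  set n := (Finset.univ.filter fun s : K →+* ℂ => s.comp e = x ∧ s ∈ Φ.1).card with hn
  set nb := (Finset.univ.filter fun t : K →+* ℂ => t.comp e = ComplexEmbedding.conjugate x ∧ t ∈ Φ.1).card with hnb
  rcases Nat.lt_or_gt_of_ne hne with hlt | hgt
  · refine ⟨nb - n - 1, by omega, not_hodgeClassesProductSpan_powSucc_curve_of_fibre_lt hk e hxΦ (by omega) hE hY⟩
  · refine ⟨n - nb - 1, by omega, not_hodgeClassesProductSpan_powSucc_curve_of_lt_fibre hk e hxΦ (by omega) hE hY⟩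

end WeilPower

end Literature.AlgebraicGeometry.ComplexMultiplication.Multiquadratic

end
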